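import Summits.QuantumAdvantage.QuantumAdvantage.Theses.ArithStatLadder

/-!
# Route `ArithStatLadder`, item `NotBPPOfNotPPoly` (stmt-QuantumAdvantage-14865)

The support item of route `QuantumAdvantage/ArithStatLadder` gluing the worst-case top
X = `IqThreeNotPPoly` (IQ3 ∉ P/poly) to the binder `IqThreeNotBPP` (IQ3 ∉ BPP):
`IqThreeNotPPoly → IqThreeNotBPP`.

Pure logic over one PROVED tree fact, Adleman's theorem `BPP ⊆ P/poly`
(`Literature.Computability.Complexity.BPP_subset_PPoly_holds`, Adleman 1978; Arora–Barak 2009,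
Thm. 7.14 — proved in `Literature/Computability/Complexity/CircuitClassesUniformProofs.lean`):
if IQ3 were in BPP it would be in P/poly, contradicting X. Nothing number-theoretic is used; the
theorem is unconditional (the fact is discharged in the tree).
-/

set_option linter.dupNamespace false -- D-0017: single-problem summit ⇒ `QuantumAdvantage.QuantumAdvantage` by design

namespace Summit.QuantumAdvantage.QuantumAdvantage.Theorems.ArithStatLadder

/-- Settles `stmt-QuantumAdvantage-14865` (route ArithStatLadder, support `NotBPPOfNotPPoly`):
if IQ3 ∉ P/poly (`IqThreeNotPPoly`) then IQ3 ∉ BPP (`IqThreeNotBPP`), by the contrapositive of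
Adleman's theorem `BPP ⊆ P/poly` (proved tree fact
`Literature.Computability.Complexity.BPP_subset_PPoly_holds`).
[cite: Adleman1978] [cite: AroraBarakCC2009, Thm. 7.14] -/
theorem NotBPPOfNotPPoly_proof :
    Summit.QuantumAdvantage.QuantumAdvantage.Theses.ArithStatLadder.NotBPPOfNotPPoly := by
  unfold Summit.QuantumAdvantage.QuantumAdvantage.Theses.ArithStatLadder.NotBPPOfNotPPoly
  intro hNotPPoly hBPP
  exact hNotPPoly (Literature.Computability.Complexity.BPP_subset_PPoly_holds hBPP)

end Summit.QuantumAdvantage.QuantumAdvantage.Theorems.ArithStatLadder
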